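import Mathlib.Analysis.SpecialFunctions.Complex.Log
import Mathlib.NumberTheory.Real.Irrational
import Mathlib.FieldTheory.Minpoly.Field
import Literature.NumberTheory.Transcendental.ExpPointsExamples
import Literature.NumberTheory.Transcendental.ZariskiDimBounds
import HarnessLib

/-!
# Sparsity at `n = 2` contains real Hermite–Lindemann and an open Shapiro instance

Write SPARSITY(2) for the statement "every `W ⊆ ℂ² × ℂ²` defined over ℚ (`IsDefinedOver ⊥ W`)
with `zariskiDim ℂ W < 2` has only finitely many ℚ-linearly independent exponential points"
(`indepExpPoints W` finite; predicted EMPTY by Schanuel's conjecture for `n = 2`; the crux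
`SparsityTwo` of the Schanuel routes). `ExpPointsExamples.lean` shows each hypothesis is
load-bearing. This file calibrates the arithmetic depth of SPARSITY(2) from below by two explicit
ℚ-curves (both taken as hypotheses `hS`, no conjecture is asserted):

* `transcendental_exp_real_of_sparsity` — SPARSITY(2) ⇒ Hermite–Lindemann for real algebraic
  `c ≠ 0` (`e^c ∉ ℚ̄`), via the ℚ-closed union of lines `{m_c(x₂) = 0, y₁ = 1, m_{e^c}(y₂) = 0}`
  (`expLinesAlg`) and the points `(2πi(k+1), c)`; dimension by
  `zariskiDim_le_of_integral_coords`.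
* `shapiroModel_finite_of_sparsity` — SPARSITY(2) ⇒ the two exponential polynomials
  `F(t) = (1-t)eᵗ-(1+t)`, `G(t) = (1-√2t)e^{√2t}-(1+√2t)` have finitely many common zeros `t ≠ 0`,
  via the ℚ-curve `shapiroW = {x₂² = 2x₁², (1-x₁)(y₁+1) = 2, (1-x₂)(y₂+1) = 2}` (graph-lift of the
  line `x₂ = √2x₁` by Cayley transforms) whose ℚ-independent exponential points are exactly
  `(t, √2t)` for such `t`. Its dimension bound is certified by `zariskiDim_le_of_integral_gens`
  over `ℂ[x₁ + y₁ + y₂]` with explicit monic sextics/octic (`shapiroPolyX₁ …`) and explicit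
  ideal-membership certificates (`shapiroW_cert_x₁ …`, checked by `linear_combination`).
  `F` and `G` are unitary-symmetric (`|eᶦᵗ| = 1 = |(1+it)/(1-it)|`), each with infinitely many
  zeros on the imaginary axis; finiteness of the COMMON zeros is a non-simple case of Shapiro's
  conjecture (D'Aquino–Macintyre–Terzo, *From Schanuel's conjecture to Shapiro's conjecture*,
  Comment. Math. Helv. 89 (2014), §§3, 5: known for Ritt-simple pairs by
  van der Poorten–Tijdeman / Skolem–Mahler–Lech, and in general under Schanuel's conjecture).

Design: hypotheses are the verbatim ∀-statement (no `def : Prop` is introduced); everything is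
sorry-free over Mathlib + the two imported files. What is NOT here: any claim about SPARSITY(2)
itself.
-/

namespace Literature.NumberTheory.Transcendental

open MvPolynomial Complex
open scoped Real

noncomputable section

/-! ## SPARSITY(2) ⇒ real Hermite–Lindemann -/

/-- The ℚ-closed set `{m_c(x₂) = 0, y₁ = 1, m_d(y₂) = 0}` (a finite union of lines) attached to
rational one-variable polynomials `mc, md`. [folklore] -/
def expLinesAlg (mc md : Polynomial ℚ) : Set (Fin 2 ⊕ Fin 2 → ℂ) :=
  {w | Polynomial.aeval (w (Sum.inl 1)) mc = 0 ∧ w (Sum.inr 0) = 1 ∧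
    Polynomial.aeval (w (Sum.inr 1)) md = 0}

/-- `expLinesAlg mc md` is defined over the prime field. [folklore] -/
theorem isDefinedOver_expLinesAlg (mc md : Polynomial ℚ) :
    IsDefinedOver (⊥ : Subfield ℂ) (expLinesAlg mc md) := by
  refine ⟨Ideal.span {Polynomial.aeval (X (Sum.inl 1) : MvPolynomial _ (⊥ : Subfield ℂ))
      (mc.map (algebraMap ℚ (⊥ : Subfield ℂ))), X (Sum.inr 0) - 1,
      Polynomial.aeval (X (Sum.inr 1) : MvPolynomial _ (⊥ : Subfield ℂ))
      (md.map (algebraMap ℚ (⊥ : Subfield ℂ)))}, ?_⟩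
  ext w
  simp only [expLinesAlg, Set.mem_setOf_eq, zeroLocus_span, Set.mem_insert_iff,
    Set.mem_singleton_iff, forall_eq_or_imp, forall_eq, aeval_polyCoord, map_sub, aeval_X,
    map_one, sub_eq_zero]

/-- `expLinesAlg mc md` has dimension `≤ 1 < 2` for monic `mc, md` (all coordinates are integral over
`ℂ[x₁]`). [folklore] -/
theorem zariskiDim_expLinesAlg {mc md : Polynomial ℚ} (hmc : mc.Monic) (hmd : md.Monic) :
    zariskiDim ℂ (expLinesAlg mc md) < 2 := by
  have hdim : ringKrullDim (MvPolynomial (Fin 1) ℂ) = (1 : ℕ) := by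
    rw [MvPolynomial.ringKrullDim_of_isNoetherianRing, ringKrullDim_eq_zero_of_field, zero_add,
      Nat.card_eq_fintype_card, Fintype.card_fin]
  refine lt_of_le_of_lt ?_ (lt_of_eq_of_lt hdim (by decide))
  refine zariskiDim_le_of_integral_coords (expLinesAlg mc md) (fun _ : Fin 1 => Sum.inl 0) ?_
  rintro (i | i) <;> fin_cases i
  · exact ⟨Polynomial.X - Polynomial.C (X 0), Polynomial.monic_X_sub_C _, fun w _ => by simp⟩
  · exact ⟨mc.map (algebraMap ℚ _), hmc.map _, fun w hw => by
      rw [eval_map_map_ratPoly]; exact hw.1⟩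
  · exact ⟨Polynomial.X - Polynomial.C 1, Polynomial.monic_X_sub_C _, fun w hw => by
      simpa [sub_eq_zero] using hw.2.1⟩
  · exact ⟨md.map (algebraMap ℚ _), hmd.map _, fun w hw => by
      rw [eval_map_map_ratPoly]; exact hw.2.2⟩

/-- **Sparsity at `n = 2` implies real Hermite–Lindemann**: if every `W ⊆ ℂ² × ℂ²` defined over
ℚ with `zariskiDim ℂ W < 2` has only finitely many ℚ-independent exponential points, then `e^c` is
transcendental for every real algebraic `c ≠ 0` (so any proof of sparsity reproves `e ∉ ℚ̄`; the
reduction is elementary — periodicity of `exp` and real/imaginary parts). Witness family: the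
ℚ-closed union of lines `{m_c(x₂) = 0, y₁ = 1, m_{e^c}(y₂) = 0}` carries `(2πi(k+1), c)`.
[folklore] -/
theorem transcendental_exp_real_of_sparsity
    (hS : ∀ W : Set (Fin 2 ⊕ Fin 2 → ℂ), IsDefinedOver (⊥ : Subfield ℂ) W → zariskiDim ℂ W < 2 →
      (indepExpPoints W).Finite)
    (c : ℝ) (hc : c ≠ 0) (halg : IsAlgebraic ℚ (c : ℂ)) : Transcendental ℚ (Complex.exp c) := by
  intro hd
  set mc := minpoly ℚ (c : ℂ) with hmc
  set md := minpoly ℚ (Complex.exp c) with hmd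
  have hci : IsIntegral ℚ (c : ℂ) := halg.isIntegral
  have hdi : IsIntegral ℚ (Complex.exp c) := hd.isIntegral
  refine Set.infinite_of_injective_forall_mem (expWitnessPt_injective (c : ℂ)) (fun k => ?_)
    (hS (expLinesAlg mc md) (isDefinedOver_expLinesAlg mc md)
      (zariskiDim_expLinesAlg (minpoly.monic hci) (minpoly.monic hdi)))
  refine ⟨linearIndependent_expWitnessPt hc k, ?_, ?_, ?_⟩
  · simp [hmc, minpoly.aeval]
  · simp
  · simp [hmd, minpoly.aeval]

/-! ## SPARSITY(2) ⇒ finiteness for the unitary-symmetric Shapiro model pair -/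

section certs
variable (x₁ x₂ y₁ y₂ : ℂ) (h1 : x₂ ^ 2 = 2 * x₁ ^ 2) (h2 : (1 - x₁) * (y₁ + 1) = 2)
  (h3 : (1 - x₂) * (y₂ + 1) = 2)
include h1 h2 h3

/-- Monic relation for `x₁` over `ℂ[u]`, `u = x₁ + y₁ + y₂`, on the model curve. [folklore] -/
theorem shapiroW_cert_x₁ : (1 : ℂ) * x₁ ^ 6 + (-2 : ℂ) * (x₁ + y₁ + y₂) * x₁ ^ 5 + (-6 : ℂ) * x₁ ^ 5 + (1 : ℂ) * (x₁ + y₁ + y₂) ^ 2 * x₁ ^ 4 + (8 : ℂ) * (x₁ + y₁ + y₂) * x₁ ^ 4 + ((17 : ℂ) / 2) * x₁ ^ 4 + (-2 : ℂ) * (x₁ + y₁ + y₂) ^ 2 * x₁ ^ 3 + (-5 : ℂ) * (x₁ + y₁ + y₂) * x₁ ^ 3 + (1 : ℂ) * x₁ ^ 3 + ((1 : ℂ) / 2) * (x₁ + y₁ + y₂) ^ 2 * x₁ ^ 2 + (-2 : ℂ) * (x₁ + y₁ + y₂) * x₁ ^ 2 + ((3 : ℂ) / 2) * x₁ ^ 2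 + (1 : ℂ) * (x₁ + y₁ + y₂) ^ 2 * x₁ + (-1 : ℂ) * (x₁ + y₁ + y₂) * x₁ + (-2 : ℂ) * x₁ + ((-1 : ℂ) / 2) * (x₁ + y₁ + y₂) ^ 2 + (2 : ℂ) * (x₁ + y₁ + y₂) + (-2 : ℂ) = 0 := by
  linear_combination (-(1 : ℂ) / 2) * (
    ((x₁ ^ 2 - ((x₁ + y₁ + y₂) + 1) * x₁ + ((x₁ + y₁ + y₂) - 2))
      - (-x₁ ^ 2 + ((x₁ + y₁ + y₂) + 3) * x₁ - (x₁ + y₁ + y₂)) * x₂)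
      * ((1 - x₂) * h2 + (1 - x₁) * h3)
    + (-x₁ ^ 2 + ((x₁ + y₁ + y₂) + 3) * x₁ - (x₁ + y₁ + y₂)) ^ 2 * h1)

/-- Monic relation for `x₂` over `ℂ[u]` on the model curve. [folklore] -/
theorem shapiroW_cert_x₂ : (1 : ℂ) * x₂ ^ 6 + (-2 : ℂ) * x₂ ^ 5 + (-2 : ℂ) * (x₁ + y₁ + y₂) ^ 2 * x₂ ^ 4 + (-8 : ℂ) * (x₁ + y₁ + y₂) * x₂ ^ 4 + (-17 : ℂ) * x₂ ^ 4 + (4 : ℂ) * (x₁ + y₁ + y₂) ^ 2 * x₂ ^ 3 + (8 : ℂ) * (x₁ + y₁ + y₂) * x₂ ^ 3 + (20 : ℂ) * x₂ ^ 3 + (2 : ℂ) * (x₁ + y₁ + y₂) ^ 2 * x₂ ^ 2 + (-10 : ℂ) * x₂ ^ 2 + (-8 : ℂ) * (x₁ + y₁ + y₂) ^ 2 * x₂ + (16 : ℂ) * (x₁ + y₁ + y₂) * x₂ + (4 : ℂ) * (x₁ + y₁ + y₂) ^ 2 + (-16 : ℂ) * (x₁ + y₁ + y₂) + (16 : ℂ)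 = 0 := by
  linear_combination
    (((1 - x₂) * x₂ ^ 2 + 2 * (((x₁ + y₁ + y₂) - 2) - (x₁ + y₁ + y₂) * x₂)
        + 2 * (-((x₁ + y₁ + y₂) + 3) * (1 - x₂) + 2) * x₁)
      - 4 * (-((x₁ + y₁ + y₂) + 3) * (1 - x₂) + 2) * x₁)
      * (2 * ((1 - x₂) * h2 + (1 - x₁) * h3) + (1 - x₂) * h1)
    - 2 * (-((x₁ + y₁ + y₂) + 3) * (1 - x₂) + 2) ^ 2 * h1

/-- Monic relation for `y₁ + 1` over `ℂ[u]` on the model curve. [folklore] -/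
theorem shapiroW_cert_y₁ : (1 : ℂ) * (y₁ + 1) ^ 6 + (-2 : ℂ) * (x₁ + y₁ + y₂) * (y₁ + 1) ^ 5 + (-14 : ℂ) * (y₁ + 1) ^ 5 + (1 : ℂ) * (x₁ + y₁ + y₂) ^ 2 * (y₁ + 1) ^ 4 + (22 : ℂ) * (x₁ + y₁ + y₂) * (y₁ + 1) ^ 4 + (21 : ℂ) * (y₁ + 1) ^ 4 + (-8 : ℂ) * (x₁ + y₁ + y₂) ^ 2 * (y₁ + 1) ^ 3 + (-28 : ℂ) * (x₁ + y₁ + y₂) * (y₁ + 1) ^ 3 + (20 : ℂ) * (y₁ + 1) ^ 3 + (8 : ℂ) * (x₁ + y₁ + y₂) ^ 2 * (y₁ + 1) ^ 2 + (-16 : ℂ) * (x₁ + y₁ + y₂) * (y₁ + 1) ^ 2 + (-52 : ℂ) * (y₁ + 1) ^ 2 + (32 : ℂ) * (x₁ + y₁ + y₂) * (y₁ + 1) + (32 : ℂ) = 0 := by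
  linear_combination (-1 : ℂ) * (
    (y₁ + 1) ^ 2 * ((-(y₁ + 1) ^ 2 + ((x₁ + y₁ + y₂) + 1) * (y₁ + 1) + 2) - 2 * (y₁ + 1)
        + x₂ * (-(y₁ + 1) ^ 2 + ((x₁ + y₁ + y₂) + 1) * (y₁ + 1) + 2))
      * (-(1 - x₂) * h2 + (y₁ + 1) * h3)
    + (-(y₁ + 1) ^ 2 + ((x₁ + y₁ + y₂) + 1) * (y₁ + 1) + 2) ^ 2
      * ((y₁ + 1) ^ 2 * h1 - 2 * ((y₁ + 1) * x₁ + (y₁ + 1) - 2) * h2))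

/-- Monic relation for `y₂ + 1` over `ℂ[u]` on the model curve. [folklore] -/
theorem shapiroW_cert_y₂ : (1 : ℂ) * (y₂ + 1) ^ 8 + (-2 : ℂ) * (x₁ + y₁ + y₂) * (y₂ + 1) ^ 7 + (8 : ℂ) * (y₂ + 1) ^ 7 + (1 : ℂ) * (x₁ + y₁ + y₂) ^ 2 * (y₂ + 1) ^ 6 + (-12 : ℂ) * (x₁ + y₁ + y₂) * (y₂ + 1) ^ 6 + ((-57 : ℂ) / 2) * (y₂ + 1) ^ 6 + (4 : ℂ) * (x₁ + y₁ + y₂) ^ 2 * (y₂ + 1) ^ 5 + (24 : ℂ) * (x₁ + y₁ + y₂) * (y₂ + 1) ^ 5 + (48 : ℂ) * (y₂ + 1) ^ 5 + (-4 : ℂ) * (x₁ + y₁ + y₂) ^ 2 * (y₂ + 1) ^ 4 + (-16 : ℂ) * (x₁ + y₁ + y₂) * (y₂ + 1) ^ 4 + (-24 : ℂ) * (y₂ + 1) ^ 4 + (-16 : ℂ) * (y₂ + 1) ^ 3 + (8 : ℂ) * (y₂ + 1) ^ 2 = 0 := by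
  linear_combination (-(1 : ℂ) / 4) * (
    (2 * (y₂ + 1) ^ 2 * ((x₁ + y₁ + y₂) + 3 - (y₂ + 1))) ^ 2
      * (((y₂ + 1) - 2 + (y₂ + 1) * x₂) * h3 + (y₂ + 1) ^ 2 * h1)
    - 2 * (y₂ + 1) ^ 2
      * (x₁ * (2 * (y₂ + 1) ^ 2 * ((x₁ + y₁ + y₂) + 3 - (y₂ + 1)))
          + (2 * (y₂ + 1) ^ 2 * ((x₁ + y₁ + y₂) - (y₂ + 1)) + ((y₂ + 1) - 2) ^ 2))
      * (2 * (y₂ + 1) ^ 2 * h2 + (y₂ + 1) ^ 2 * h1 + ((y₂ + 1) - 2 + (y₂ + 1) * x₂) * h3))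

end certs

/-! ### The model curve as a subset of `ℂ² × ℂ²` -/

/-- The unitary-symmetric Shapiro model curve
`W = {x₂² = 2x₁², (1 - x₁)(y₁ + 1) = 2, (1 - x₂)(y₂ + 1) = 2}` (the ℚ-closure of the graph-lift
of the line `x₂ = √2·x₁` by the Cayley transforms `y_j = (1 + x_j)/(1 - x_j)`). [folklore] -/
def shapiroW : Set (Fin 2 ⊕ Fin 2 → ℂ) :=
  {w | w (Sum.inl 1) ^ 2 = 2 * w (Sum.inl 0) ^ 2 ∧ (1 - w (Sum.inl 0)) * (w (Sum.inr 0) + 1) = 2 ∧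
    (1 - w (Sum.inl 1)) * (w (Sum.inr 1) + 1) = 2}

/-- `shapiroW` is defined over the prime field. [folklore] -/
theorem isDefinedOver_shapiroW : IsDefinedOver (⊥ : Subfield ℂ) shapiroW := by
  refine ⟨Ideal.span {X (Sum.inl 1) ^ 2 - 2 * X (Sum.inl 0) ^ 2,
    (1 - X (Sum.inl 0)) * (X (Sum.inr 0) + 1) - 2, (1 - X (Sum.inl 1)) * (X (Sum.inr 1) + 1) - 2}, ?_⟩
  ext w
  simp only [shapiroW, Set.mem_setOf_eq, zeroLocus_span, Set.mem_insert_iff,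
    Set.mem_singleton_iff, forall_eq_or_imp, forall_eq, map_sub, map_mul, map_add, map_pow,
    aeval_X, map_one, map_ofNat, sub_eq_zero]

/-- Monic sextic over `ℂ[u]` killing `x₁` on `shapiroW` (`u = x₁ + y₁ + y₂`). [folklore] -/
def shapiroPolyX₁ : Polynomial (MvPolynomial (Fin 1) ℂ) :=
  Polynomial.X ^ 6 +
      Polynomial.C (MvPolynomial.C (-6 : ℂ) + MvPolynomial.C (-2 : ℂ) * X 0) * Polynomial.X ^ 5 +
      Polynomial.C (MvPolynomial.C ((17 : ℂ) / 2) + MvPolynomial.C (8 : ℂ) * X 0 + MvPolynomial.C (1 : ℂ) * X 0 ^ 2) * Polynomial.X ^ 4 +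
      Polynomial.C (MvPolynomial.C (1 : ℂ) + MvPolynomial.C (-5 : ℂ) * X 0 + MvPolynomial.C (-2 : ℂ) * X 0 ^ 2) * Polynomial.X ^ 3 +
      Polynomial.C (MvPolynomial.C ((3 : ℂ) / 2) + MvPolynomial.C (-2 : ℂ) * X 0 + MvPolynomial.C ((1 : ℂ) / 2) * X 0 ^ 2) * Polynomial.X ^ 2 +
      Polynomial.C (MvPolynomial.C (-2 : ℂ) + MvPolynomial.C (-1 : ℂ) * X 0 + MvPolynomial.C (1 : ℂ) * X 0 ^ 2) * Polynomial.X +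
      Polynomial.C (MvPolynomial.C (-2 : ℂ) + MvPolynomial.C (2 : ℂ) * X 0 + MvPolynomial.C ((-1 : ℂ) / 2) * X 0 ^ 2)

/-- Monic sextic over `ℂ[u]` killing `x₂` on `shapiroW`. [folklore] -/
def shapiroPolyX₂ : Polynomial (MvPolynomial (Fin 1) ℂ) :=
  Polynomial.X ^ 6 +
      Polynomial.C (MvPolynomial.C (-2 : ℂ)) * Polynomial.X ^ 5 +
      Polynomial.C (MvPolynomial.C (-17 : ℂ) + MvPolynomial.C (-8 : ℂ) * X 0 + MvPolynomial.C (-2 : ℂ) * X 0 ^ 2) * Polynomial.X ^ 4 +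
      Polynomial.C (MvPolynomial.C (20 : ℂ) + MvPolynomial.C (8 : ℂ) * X 0 + MvPolynomial.C (4 : ℂ) * X 0 ^ 2) * Polynomial.X ^ 3 +
      Polynomial.C (MvPolynomial.C (-10 : ℂ) + MvPolynomial.C (2 : ℂ) * X 0 ^ 2) * Polynomial.X ^ 2 +
      Polynomial.C (MvPolynomial.C (16 : ℂ) * X 0 + MvPolynomial.C (-8 : ℂ) * X 0 ^ 2) * Polynomial.X +
      Polynomial.C (MvPolynomial.C (16 : ℂ) + MvPolynomial.C (-16 : ℂ) * X 0 + MvPolynomial.C (4 : ℂ) * X 0 ^ 2)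

/-- Monic sextic over `ℂ[u]` killing `y₁ + 1` on `shapiroW`. [folklore] -/
def shapiroPolyY₁ : Polynomial (MvPolynomial (Fin 1) ℂ) :=
  Polynomial.X ^ 6 +
      Polynomial.C (MvPolynomial.C (-14 : ℂ) + MvPolynomial.C (-2 : ℂ) * X 0) * Polynomial.X ^ 5 +
      Polynomial.C (MvPolynomial.C (21 : ℂ) + MvPolynomial.C (22 : ℂ) * X 0 + MvPolynomial.C (1 : ℂ) * X 0 ^ 2) * Polynomial.X ^ 4 +
      Polynomial.C (MvPolynomial.C (20 : ℂ) + MvPolynomial.C (-28 : ℂ) * X 0 + MvPolynomial.C (-8 : ℂ) * X 0 ^ 2) * Polynomial.X ^ 3 +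
      Polynomial.C (MvPolynomial.C (-52 : ℂ) + MvPolynomial.C (-16 : ℂ) * X 0 + MvPolynomial.C (8 : ℂ) * X 0 ^ 2) * Polynomial.X ^ 2 +
      Polynomial.C (MvPolynomial.C (32 : ℂ) * X 0) * Polynomial.X +
      Polynomial.C (MvPolynomial.C (32 : ℂ))

/-- Monic octic over `ℂ[u]` killing `y₂ + 1` on `shapiroW`. [folklore] -/
def shapiroPolyY₂ : Polynomial (MvPolynomial (Fin 1) ℂ) :=
  Polynomial.X ^ 8 +
      Polynomial.C (MvPolynomial.C (8 : ℂ) + MvPolynomial.C (-2 : ℂ) * X 0) * Polynomial.X ^ 7 +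
      Polynomial.C (MvPolynomial.C ((-57 : ℂ) / 2) + MvPolynomial.C (-12 : ℂ) * X 0 + MvPolynomial.C (1 : ℂ) * X 0 ^ 2) * Polynomial.X ^ 6 +
      Polynomial.C (MvPolynomial.C (48 : ℂ) + MvPolynomial.C (24 : ℂ) * X 0 + MvPolynomial.C (4 : ℂ) * X 0 ^ 2) * Polynomial.X ^ 5 +
      Polynomial.C (MvPolynomial.C (-24 : ℂ) + MvPolynomial.C (-16 : ℂ) * X 0 + MvPolynomial.C (-4 : ℂ) * X 0 ^ 2) * Polynomial.X ^ 4 +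
      Polynomial.C (MvPolynomial.C (-16 : ℂ)) * Polynomial.X ^ 3 +
      Polynomial.C (MvPolynomial.C (8 : ℂ)) * Polynomial.X ^ 2

/-- `shapiroPolyX₁` is monic. [folklore] -/
theorem monic_shapiroPolyX₁ : shapiroPolyX₁.Monic := by unfold shapiroPolyX₁; monicity!
/-- `shapiroPolyX₂` is monic. [folklore] -/
theorem monic_shapiroPolyX₂ : shapiroPolyX₂.Monic := by unfold shapiroPolyX₂; monicity!
/-- `shapiroPolyY₁` is monic. [folklore] -/
theorem monic_shapiroPolyY₁ : shapiroPolyY₁.Monic := by unfold shapiroPolyY₁; monicity!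
/-- `shapiroPolyY₂` is monic. [folklore] -/
theorem monic_shapiroPolyY₂ : shapiroPolyY₂.Monic := by unfold shapiroPolyY₂; monicity!


/-- `shapiroW` has dimension `≤ 1 < 2`: every coordinate is integral over `ℂ[x₁ + y₁ + y₂]`
(explicit monic relations `shapiroPolyX₁, shapiroPolyX₂, shapiroPolyY₁(T+1), shapiroPolyY₂(T+1)` with ideal-membership certificates
`shapiroW_cert_x₁ … shapiroW_cert_y₂`). [folklore] -/
theorem zariskiDim_shapiroW : zariskiDim ℂ shapiroW < 2 := by
  have hdim : ringKrullDim (MvPolynomial (Fin 1) ℂ) = (1 : ℕ) := by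
    rw [MvPolynomial.ringKrullDim_of_isNoetherianRing, ringKrullDim_eq_zero_of_field, zero_add,
      Nat.card_eq_fintype_card, Fintype.card_fin]
  refine lt_of_le_of_lt ?_ (lt_of_eq_of_lt hdim (by decide))
  refine zariskiDim_le_of_integral_gens shapiroW
    (fun _ : Fin 1 => X (Sum.inl 0) + X (Sum.inr 0) + X (Sum.inr 1)) ?_
  have hq : (Polynomial.X + 1 : Polynomial (MvPolynomial (Fin 1) ℂ)).Monic ∧
      (Polynomial.X + 1 : Polynomial (MvPolynomial (Fin 1) ℂ)).natDegree ≠ 0 := by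
    have h := Polynomial.monic_X_add_C (1 : MvPolynomial (Fin 1) ℂ)
    have h' := Polynomial.natDegree_X_add_C (1 : MvPolynomial (Fin 1) ℂ)
    simp only [map_one] at h h'
    exact ⟨h, by rw [h']; exact one_ne_zero⟩
  rintro (i | i) <;> fin_cases i
  · refine ⟨shapiroPolyX₁, monic_shapiroPolyX₁, fun w hw => ?_⟩
    obtain ⟨h1, h2, h3⟩ := hw
    simp only [shapiroPolyX₁, Polynomial.eval_map, Polynomial.eval₂_add, Polynomial.eval₂_mul,
      Polynomial.eval₂_pow, Polynomial.eval₂_X, Polynomial.eval₂_C, MvPolynomial.eval_C,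
      MvPolynomial.eval_X, map_add, map_mul, map_pow, Fin.zero_eta, Fin.isValue]
    linear_combination shapiroW_cert_x₁ _ _ _ _ h1 h2 h3
  · refine ⟨shapiroPolyX₂, monic_shapiroPolyX₂, fun w hw => ?_⟩
    obtain ⟨h1, h2, h3⟩ := hw
    simp only [shapiroPolyX₂, Polynomial.eval_map, Polynomial.eval₂_add, Polynomial.eval₂_mul,
      Polynomial.eval₂_pow, Polynomial.eval₂_X, Polynomial.eval₂_C, MvPolynomial.eval_C,
      MvPolynomial.eval_X, map_add, map_mul, map_pow, Fin.mk_one, Fin.isValue]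
    linear_combination shapiroW_cert_x₂ _ _ _ _ h1 h2 h3
  · refine ⟨shapiroPolyY₁.comp (Polynomial.X + 1), monic_shapiroPolyY₁.comp hq.1 hq.2, fun w hw => ?_⟩
    obtain ⟨h1, h2, h3⟩ := hw
    rw [Polynomial.map_comp, Polynomial.eval_comp]
    simp only [shapiroPolyY₁, Polynomial.map_add, Polynomial.map_X, Polynomial.map_one,
      Polynomial.eval_add, Polynomial.eval_X, Polynomial.eval_one,
      Polynomial.eval_map, Polynomial.eval₂_add, Polynomial.eval₂_mul,
      Polynomial.eval₂_pow, Polynomial.eval₂_X, Polynomial.eval₂_C, MvPolynomial.eval_C,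
      MvPolynomial.eval_X, map_add, map_mul, map_pow, Fin.zero_eta, Fin.isValue]
    linear_combination shapiroW_cert_y₁ _ _ _ _ h1 h2 h3
  · refine ⟨shapiroPolyY₂.comp (Polynomial.X + 1), monic_shapiroPolyY₂.comp hq.1 hq.2, fun w hw => ?_⟩
    obtain ⟨h1, h2, h3⟩ := hw
    rw [Polynomial.map_comp, Polynomial.eval_comp]
    simp only [shapiroPolyY₂, Polynomial.map_add, Polynomial.map_X, Polynomial.map_one,
      Polynomial.eval_add, Polynomial.eval_X, Polynomial.eval_one,
      Polynomial.eval_map, Polynomial.eval₂_add, Polynomial.eval₂_mul,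
      Polynomial.eval₂_pow, Polynomial.eval₂_X, Polynomial.eval₂_C, MvPolynomial.eval_C,
      MvPolynomial.eval_X, map_add, map_mul, map_pow, Fin.mk_one, Fin.isValue]
    linear_combination shapiroW_cert_y₂ _ _ _ _ h1 h2 h3

/-! ### The calibration -/

/-- `(t, √2·t)` is ℚ-linearly independent for `t ≠ 0` (irrationality of `√2`). [folklore] -/
theorem linearIndependent_sqrt_two_mul {t : ℂ} (ht : t ≠ 0) :
    LinearIndependent ℚ ![t, (Real.sqrt 2 : ℂ) * t] := by
  rw [LinearIndependent.pair_iff]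
  intro s r hsr
  rw [Rat.smul_def, Rat.smul_def] at hsr
  have h1 : ((s : ℂ) + (r : ℂ) * (Real.sqrt 2 : ℂ)) * t = 0 := by linear_combination hsr
  have h2 : (s : ℂ) + (r : ℂ) * (Real.sqrt 2 : ℂ) = 0 := by
    rcases mul_eq_zero.1 h1 with h | h
    · exact h
    · exact absurd h ht
  have h3 : (s : ℝ) + (r : ℝ) * Real.sqrt 2 = 0 := by
    have := congrArg Complex.re h2
    simpa using this
  have hr : r = 0 := by
    by_contra hr
    have hr' : (r : ℝ) ≠ 0 := by exact_mod_cast hr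
    have : Real.sqrt 2 = ((-s / r : ℚ) : ℝ) := by
      push_cast
      field_simp
      linear_combination h3
    exact (irrational_sqrt_two.ne_rat _) this
  refine ⟨?_, hr⟩
  have : (s : ℝ) = 0 := by simpa [hr] using h3
  exact_mod_cast this

/-- **Sparsity at `n = 2` implies Shapiro-type finiteness for the unitary-symmetric model pair**
`F(t) = (1 - t)eᵗ - (1 + t)`, `G(t) = (1 - √2 t)e^{√2 t} - (1 + √2 t)`: if every `W` defined over
ℚ with `zariskiDim ℂ W < 2` has finitely many ℚ-independent exponential points, then `F, G` have
only finitely many common zeros `t ≠ 0`. (Each of `F`, `G` has infinitely many zeros `± i t_n`,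
`t_n - 2 arctan t_n ∈ 2πℤ`; at those, the phase of the other misses `2πℤ` by
`2π‖√2 n + (√2-1)/2‖ - √2/t_n + O(t_n⁻³)`: an inhomogeneous Diophantine coincidence at the
Dirichlet scale — the finiteness of common zeros is a non-simple case of Shapiro's conjecture, known
under Schanuel's conjecture only; D'Aquino–Macintyre–Terzo 2014 §§3,5.) [folklore] -/
theorem shapiroModel_finite_of_sparsity
    (hS : ∀ W : Set (Fin 2 ⊕ Fin 2 → ℂ), IsDefinedOver (⊥ : Subfield ℂ) W → zariskiDim ℂ W < 2 →
      (indepExpPoints W).Finite) :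
    Set.Finite {t : ℂ | t ≠ 0 ∧ (1 - t) * Complex.exp t = 1 + t ∧
      (1 - (Real.sqrt 2 : ℂ) * t) * Complex.exp ((Real.sqrt 2 : ℂ) * t) =
        1 + (Real.sqrt 2 : ℂ) * t} := by
  have hfin := hS shapiroW isDefinedOver_shapiroW zariskiDim_shapiroW
  let m : ℂ → (Fin 2 → ℂ) := fun t => ![t, (Real.sqrt 2 : ℂ) * t]
  have hm : Function.Injective m := fun a b hab => by
    have := congrFun hab 0
    simpa [m] using this
  refine (hfin.preimage (hm.injOn)).subset ?_
  rintro t ⟨ht, hF, hG⟩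
  refine ⟨linearIndependent_sqrt_two_mul ht, ?_, ?_, ?_⟩
  · simp only [m, Sum.elim_inl, Matrix.cons_val_one, Matrix.cons_val_zero,
      Matrix.cons_val_fin_one]
    have hs : ((Real.sqrt 2 : ℝ) : ℂ) ^ 2 = 2 := by
      rw [← Complex.ofReal_pow, Real.sq_sqrt (by norm_num : (0 : ℝ) ≤ 2)]
      push_cast
      rfl
    linear_combination t ^ 2 * hs
  · simp only [m, Sum.elim_inl, Sum.elim_inr, Function.comp_apply, Matrix.cons_val_zero]
    linear_combination hF
  · simp only [m, Sum.elim_inl, Sum.elim_inr, Function.comp_apply, Matrix.cons_val_one,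
      Matrix.cons_val_fin_one]
    linear_combination hG


end

end Literature.NumberTheory.Transcendental
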